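import Literature.Probability.LatticeModels.RandomClusterRegionCrossingBound
import Literature.Probability.LatticeModels.RandomClusterIsoInvariance
import HarnessLib

/-!
# An insulated open circuit in a wired lattice annulus of the critical FK-Ising model

Topic `Literature/Probability/LatticeModels` (family `crit-ising`). The FK-side of the transfer of
the RSW theory of the critical FK-Ising model (`fkIsing_rsw`, `fkIsing_annulusCrossing_le`,
`FKIsingRSW.lean`) to the critical spin-Ising model through the Edwards–Sokal coupling
(`IsingEdwardsSokalCoupling.lean`), after Chelkak–Duminil-Copin–Hongler (Electron. J. Probab. 21
(2016), §5.3, proof of Cor. 1.7: dual crossings insulate a region in which, with free boundary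
conditions, an open crossing is found; "with probability `1/2` this cluster has spin `-1`") and
Kemppainen–Smirnov (Ann. Probab. 45 (2017), Rem. 2.10 and §4.1.6: only regular annuli are
needed). For a finite graph `G` embedded in `ℤ²` (`ι : V ↪ ℤ²`, edges are lattice edges)
containing the full lattice annulus `x₀ + S_{6n,12n}` and wired on a set `B` of vertices at
sup-norm levels `≤ n` or `≥ 29n` around `x₀` (the use: the Edwards–Sokal graph of the lattice
annulus `{n < ‖x - x₀‖_∞ < 29n}` wired on its two boundary squares), consider the event
`insulatedCircuitEvent`:

* no open path of `G` inside the band of levels `[n, 5n]` joins level `n` to level `5n`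
  (`innerCross`ᶜ), and none inside the band `[13n, 29n]` joins level `13n` to level `29n`
  (`outerCross`ᶜ);
* each of the four `24n × 6n` rectangles forming the annulus `x₀ + S_{6n,12n}` is crossed in its
  long direction by an open path of the rectangle (`circuitEvent`; Duminil-Copin–Smirnov 2012,
  proof of Lemma 6.3: "one can construct from them a circuit").

`le_rcMeasure_real_insulatedCircuitEvent`: under the critical FK-Ising measure of `G` wired on
`B`, this event has probability `≥ (1 - c)² c₀⁴ > 0` uniformly in `G`, `x₀`, `n ≥ 1`, where
`c < 1` is the constant of `fkIsing_annulusCrossing_le` (DCS Lemma 6.3) and `c₀ > 0` that of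
`fkIsing_rsw` (DCS Thm. 3.16). Proof: the two "no crossing" factors cost `(1 - c)` each
conditionally on everything else (`rcMeasure_real_regionCrossing_inter_regionCyl_le`, the tree's
one-arm bound uniform in the configuration off a band, with the annuli `S_{2n,4n}` and
`S_{14n,28n}`); the circuit has probability `≥ c₀⁴` by monotonicity in the domain for free
boundary conditions (`rcMeasure_fromEdgeSet_real_le`), FKG (`rcMeasure_fkg_holds`) and Thm. 3.16
in translated / transposed rectangles (`fkIsing_rsw.shift`, `fkIsing_rsw.transpose_shift`).
The geometric consequences (the circuit's cluster avoids `B` and blocks every `∗`-path across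
`S_{6n,12n}`) are proved separately (companion file `IsingAnnulusCircuitGeometry.lean`).

## References

* H. Duminil-Copin, S. Smirnov, *Conformal invariance of lattice models*, Clay Math. Proc. 15
  (2012), Thm. 3.16, Lemma 6.3 and the proof of Thm. 6.1 — `DuminilCopinSmirnov2012Clay`.
* D. Chelkak, H. Duminil-Copin, C. Hongler, Electron. J. Probab. 21 (2016), §5.3 —
  `ChelkakDuminilCopinHongler2016`.
* A. Kemppainen, S. Smirnov, Ann. Probab. 45 (2017), Rem. 2.10, §4.1.6 — `KemppainenSmirnov2017`.
* G. Grimmett, *The Random-Cluster Model* (2006), Thm. 3.8, Lemma 4.13, Lemma 4.14 — `Grimmett2006`.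
-/

noncomputable section

namespace Literature.Probability.LatticeModels

open Finset SimpleGraph _root_.MeasureTheory Literature.Probability.Percolation

/-! ### The regions and the events -/

section Defs

variable {V : Type*} [Fintype V] [DecidableEq V] (G : SimpleGraph V) [DecidableRel G.Adj]
  (ι : V ↪ Site 2) (x₀ : Site 2)

/-- The edges of `G` in the band of sup-norm levels `[a, b]` around `x₀` (both endpoints at level
in `[a, b]`). (DCS 2012, §6.1, the square annuli `S_{r,R}(x)`.) [cite: DuminilCopinSmirnov2012Clay, §6.1] -/
def bandEdges (a b : ℤ) : Finset (Sym2 V) :=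
  G.edgeFinset.filter fun e ↦ ∀ v ∈ e, a ≤ supLevel x₀ (ι v) ∧ supLevel x₀ (ι v) ≤ b

variable {G ι x₀} in
/-- Membership in `bandEdges`. [folklore] -/
theorem mem_bandEdges {a b : ℤ} {e : Sym2 V} :
    e ∈ bandEdges G ι x₀ a b ↔ e ∈ G.edgeFinset ∧ ∀ v ∈ e, a ≤ supLevel x₀ (ι v) ∧ supLevel x₀ (ι v) ≤ b := by
  rw [bandEdges, Finset.mem_filter]

/-- The long rectangle of the annulus `S_{6n,12n}` in the outward direction `ℓ = ε y_i`
(`i ∈ {0, 1}`, `ε = ±1`), in coordinates `y = x - x₀`: `6n ≤ ε y_i ≤ 12n`, `|y_{1-i}| ≤ 12n`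
(DCS 2012, proof of Lemma 6.3: `R_T, R_B, R_R, R_L`, here `24n × 6n`). [cite: DuminilCopinSmirnov2012Clay, proof of Lemma 6.3] -/
def InRect (n : ℕ) (i : Fin 2) (ε : ℤˣ) (y : Site 2) : Prop :=
  6 * (n : ℤ) ≤ (ε : ℤ) * y i ∧ (ε : ℤ) * y i ≤ 12 * n ∧ |y i.rev| ≤ 12 * n

/-- Membership in the rectangle is decidable (integer inequalities). [folklore] -/
instance (n : ℕ) (i : Fin 2) (ε : ℤˣ) : DecidablePred (InRect n i ε) := fun y ↦ by
  unfold InRect; infer_instance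

/-- The edges of `G` with both endpoints in the rectangle `(i, ε)`. [cite: DuminilCopinSmirnov2012Clay, proof of Lemma 6.3] -/
def rectEdges (n : ℕ) (i : Fin 2) (ε : ℤˣ) : Finset (Sym2 V) :=
  G.edgeFinset.filter fun e ↦ ∀ v ∈ e, InRect n i ε (ι v - x₀)

/-- The vertices on the short side `{y_{1-i} = -12n}` of the rectangle `(i, ε)`. [cite: DuminilCopinSmirnov2012Clay, proof of Lemma 6.3] -/
def rectIn (n : ℕ) (i : Fin 2) (ε : ℤˣ) : Finset V :=
  Finset.univ.filter fun v ↦ InRect n i ε (ι v - x₀) ∧ (ι v - x₀) i.rev = -(12 * n)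

/-- The vertices on the short side `{y_{1-i} = 12n}` of the rectangle `(i, ε)`. [cite: DuminilCopinSmirnov2012Clay, proof of Lemma 6.3] -/
def rectOut (n : ℕ) (i : Fin 2) (ε : ℤˣ) : Finset V :=
  Finset.univ.filter fun v ↦ InRect n i ε (ι v - x₀) ∧ (ι v - x₀) i.rev = 12 * n

/-- **Long-way open crossing of the rectangle `(i, ε)`**: an open path of edges of the rectangle
from its short side `{y_{1-i} = -12n}` to its short side `{y_{1-i} = 12n}` (DCS 2012, proof of
Lemma 6.3: "a path crossing each of these rectangles in the longer direction"). [cite: DuminilCopinSmirnov2012Clay, proof of Lemma 6.3] -/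
def rectCross (n : ℕ) (i : Fin 2) (ε : ℤˣ) : Set (Percolation.BondConfig V) :=
  regionCrossing (rectEdges G ι x₀ n i ε) (rectIn ι x₀ n i ε) (rectOut ι x₀ n i ε)

/-- **The circuit event**: all four rectangles of `x₀ + S_{6n,12n}` are crossed the long way by
open paths ("one can construct from them a circuit", DCS 2012, proof of Lemma 6.3).
[cite: DuminilCopinSmirnov2012Clay, proof of Lemma 6.3] -/
def circuitEvent (n : ℕ) : Set (Percolation.BondConfig V) :=
  ⋂ i : Fin 2, ⋂ ε : ℤˣ, rectCross G ι x₀ n i ε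

/-- An open path inside the band of levels `[n, 5n]` from level `n` to level `5n`. [cite: DuminilCopinSmirnov2012Clay, §6.1] -/
def innerCross (n : ℕ) : Set (Percolation.BondConfig V) :=
  regionCrossing (bandEdges G ι x₀ n (5 * n)) (supLevelSet ι x₀ n) (supLevelSet ι x₀ (5 * n))

/-- An open path inside the band of levels `[13n, 29n]` from level `13n` to level `29n`. [cite: DuminilCopinSmirnov2012Clay, §6.1] -/
def outerCross (n : ℕ) : Set (Percolation.BondConfig V) :=
  regionCrossing (bandEdges G ι x₀ (13 * n) (29 * n)) (supLevelSet ι x₀ (13 * n))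
    (supLevelSet ι x₀ (29 * n))

/-- **The insulated circuit event** (after Chelkak–Duminil-Copin–Hongler 2016, §5.3): no crossing
of the band `[n, 5n]`, the circuit event in `S_{6n,12n}`, and no crossing of the band
`[13n, 29n]`. [cite: ChelkakDuminilCopinHongler2016, §5.3, proof of Cor. 1.7] -/
def insulatedCircuitEvent (n : ℕ) : Set (Percolation.BondConfig V) :=
  (innerCross G ι x₀ n)ᶜ ∩ (circuitEvent G ι x₀ n ∩ (outerCross G ι x₀ n)ᶜ)

end Defs

/-! ### Determinedness and monotonicity of the events -/

section Determined

variable {V : Type*} [Fintype V] [DecidableEq V] (G : SimpleGraph V) [DecidableRel G.Adj]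
  (ι : V ↪ Site 2) (x₀ : Site 2)

omit [Fintype V] [DecidableEq V] in
/-- A region crossing is determined by the configuration on the region. [folklore] -/
theorem mem_regionCrossing_iff_of_inter_eq {U : Finset (Sym2 V)} {In Out : Finset V}
    {ω₁ ω₂ : Percolation.BondConfig V} (h : ω₁ ∩ ↑U = ω₂ ∩ ↑U) :
    ω₁ ∈ regionCrossing U In Out ↔ ω₂ ∈ regionCrossing U In Out := by
  simp only [regionCrossing, Set.mem_setOf_eq, regionGraph_eq_of_inter_eq h]

omit [Fintype V] [DecidableEq V] in
/-- A region crossing is determined by the configuration on any larger region. [folklore] -/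
theorem mem_regionCrossing_iff_of_inter_eq_of_subset {U U' : Finset (Sym2 V)} (hUU' : U ⊆ U')
    {In Out : Finset V} {ω₁ ω₂ : Percolation.BondConfig V} (h : ω₁ ∩ ↑U' = ω₂ ∩ ↑U') :
    ω₁ ∈ regionCrossing U In Out ↔ ω₂ ∈ regionCrossing U In Out := by
  refine mem_regionCrossing_iff_of_inter_eq ?_
  have hsub : (↑U : Set (Sym2 V)) ⊆ ↑U' := Finset.coe_subset.2 hUU'
  calc ω₁ ∩ ↑U = (ω₁ ∩ ↑U') ∩ ↑U := by rw [Set.inter_assoc, Set.inter_eq_right.2 hsub]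
    _ = (ω₂ ∩ ↑U') ∩ ↑U := by rw [h]
    _ = ω₂ ∩ ↑U := by rw [Set.inter_assoc, Set.inter_eq_right.2 hsub]

omit [Fintype V] [DecidableEq V] in
/-- A region crossing only uses the edges of the region: `{ω | ω ∩ U ∈ C} = C`. [folklore] -/
theorem setOf_inter_mem_regionCrossing (U : Finset (Sym2 V)) (In Out : Finset V) :
    {ω : Percolation.BondConfig V | ω ∩ ↑U ∈ regionCrossing U In Out} = regionCrossing U In Out := by
  ext ω
  exact mem_regionCrossing_iff_of_inter_eq (by rw [Set.inter_assoc, Set.inter_self])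

/-- The rectangle edges lie in the band `[6n, 12n]`. [folklore] -/
theorem rectEdges_subset_bandEdges (n : ℕ) (i : Fin 2) (ε : ℤˣ) :
    rectEdges G ι x₀ n i ε ⊆ bandEdges G ι x₀ (6 * n) (12 * n) := by
  intro e he
  rw [rectEdges, Finset.mem_filter] at he
  rw [mem_bandEdges]
  refine ⟨he.1, fun v hv ↦ ?_⟩
  obtain ⟨h1, h2, h3⟩ := he.2 v hv
  have hle := units_mul_le_max_abs (ι v - x₀) i ε
  have hab := abs_le.1 h3
  unfold supLevel
  constructor
  · exact h1.trans hle
  · have : |(ι v - x₀) i| ≤ 12 * n := by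
      rcases Int.units_eq_one_or ε with rfl | rfl
      · simp only [Units.val_one, one_mul] at h1 h2; rw [abs_le]; constructor <;> omega
      · simp only [Units.val_neg, Units.val_one, neg_mul, one_mul] at h1 h2; rw [abs_le]; constructor <;> omega
    fin_cases i
    · exact max_le this (by simpa using h3)
    · exact max_le (by simpa using h3) this

/-- The circuit event is determined by the configuration on the band `[6n, 12n]`. [folklore] -/
theorem mem_circuitEvent_iff_of_inter_eq (n : ℕ) {ω₁ ω₂ : Percolation.BondConfig V}
    (h : ω₁ ∩ ↑(bandEdges G ι x₀ (6 * n) (12 * n)) = ω₂ ∩ ↑(bandEdges G ι x₀ (6 * n) (12 * n))) :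
    ω₁ ∈ circuitEvent G ι x₀ n ↔ ω₂ ∈ circuitEvent G ι x₀ n := by
  simp only [circuitEvent, Set.mem_iInter]
  refine forall_congr' fun i ↦ forall_congr' fun ε ↦ ?_
  exact mem_regionCrossing_iff_of_inter_eq_of_subset (rectEdges_subset_bandEdges G ι x₀ n i ε) h

/-- The circuit event is increasing. [folklore] -/
theorem isUpperSet_circuitEvent (n : ℕ) : IsUpperSet (circuitEvent G ι x₀ n) := by
  unfold circuitEvent
  exact isUpperSet_iInter fun i ↦ isUpperSet_iInter fun ε ↦ isUpperSet_regionCrossing _ _ _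

/-- Bands at disjoint level ranges have disjoint edge sets. [folklore] -/
theorem disjoint_bandEdges {a b a' b' : ℤ} (h : b < a') :
    Disjoint (bandEdges G ι x₀ a b) (bandEdges G ι x₀ a' b') := by
  rw [Finset.disjoint_left]
  intro e he he'
  rw [mem_bandEdges] at he he'
  induction e using Sym2.ind with
  | h u v =>
    have h1 := (he.2 u (Sym2.mem_mk_left u v)).2
    have h2 := (he'.2 u (Sym2.mem_mk_left u v)).1
    omega

end Determined

/-! ### The two "no crossing" factors: the one-arm bound uniform in the configuration off a band -/

section NoCrossing

variable {V : Type*} [Fintype V] [DecidableEq V] (G : SimpleGraph V) [DecidableRel G.Adj]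
  (ι : V ↪ Site 2) (x₀ : Site 2)

/-- **A band crossing costs a wired-annulus crossing, conditionally on everything off the band.**
Let the edges of `G` be lattice edges under `ι`, let the wired set `B` consist of vertices at
levels `≤ lo` or `≥ hi`, and let `lo < m`, `2m < hi` (`m ≥ 1`). Then for every configuration `ξ`
off the band `[lo, hi]`,
`φ^B_G(crossing of the band from level lo to level hi ∩ {ω ∖ U = ξ}) ≤ c · φ^B_G({ω ∖ U = ξ})`,
where `c ≥ 0` bounds the probability of an open inner-to-outer crossing of the annulus `S_{m,2m}`
under its random-cluster measure wired on both boundary squares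
(`rcMeasure_real_regionCrossing_inter_regionCyl_le` with one annulus).
[cite: DuminilCopinSmirnov2012Clay, Thm. 6.1 (proof) and Lemma 6.3] -/
theorem real_bandCross_inter_cyl_le {p q : ℝ} (hp : p ∈ Set.Icc (0 : ℝ) 1) (hp1 : p < 1)
    (hq : 1 ≤ q) (B : Set V) (hGlat : ∀ u v : V, G.Adj u v → (zdGraph 2).Adj (ι u) (ι v))
    {lo hi : ℤ} {m : ℕ} (hm : 1 ≤ m) (hlo : lo < m) (hhi : 2 * (m : ℤ) < hi)
    (hB : ∀ v ∈ B, supLevel x₀ (ι v) ≤ lo ∨ hi ≤ supLevel x₀ (ι v))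
    {c : ℝ} (hc : 0 ≤ c)
    (hann : (rcMeasure (finsetGraph (zdGraph 2) (squareAnnulusSites m)) p q
        (squareAnnulusInner m ∪ squareAnnulusOuter m)).real
        (openCrossing Set.univ (squareAnnulusInner m) (squareAnnulusOuter m)) ≤ c)
    (ξ : Finset (Sym2 V)) (hξ : ξ ⊆ G.edgeFinset \ bandEdges G ι x₀ lo hi) :
    (rcMeasure G p q B).real
        (regionCrossing (bandEdges G ι x₀ lo hi) (supLevelSet ι x₀ lo) (supLevelSet ι x₀ hi) ∩
          regionCyl (bandEdges G ι x₀ lo hi) ξ) ≤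
      c * (rcMeasure G p q B).real (regionCyl (bandEdges G ι x₀ lo hi) ξ) := by
  set U := bandEdges G ι x₀ lo hi with hU
  have hUE : U ⊆ G.edgeFinset := Finset.filter_subset _ _
  set T : Set V := {v | supLevel x₀ (ι v) = lo ∨ supLevel x₀ (ι v) = hi} with hT
  have hins : RegionInsulated B T U ξ := by
    intro e he v hv hB'
    obtain ⟨heE, hlev⟩ := mem_bandEdges.1 he
    obtain ⟨hv1, hv2⟩ := hlev v hv
    rcases hB' with hvB | ⟨e', he', hve'⟩
    · rcases hB v hvB with h | h
      · exact Or.inl (le_antisymm h hv1)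
      · exact Or.inr (le_antisymm hv2 h)
    · -- `e'` is an edge of `G` off the band with endpoint `v` in the band: `v` is on a rim
      have he'E : e' ∈ G.edgeFinset := (Finset.mem_sdiff.1 (hξ he')).1
      have he'U : e' ∉ U := (Finset.mem_sdiff.1 (hξ he')).2
      by_contra hvT
      simp only [hT, Set.mem_setOf_eq, not_or] at hvT
      apply he'U
      rw [mem_bandEdges]
      refine ⟨he'E, fun w hw ↦ ?_⟩
      -- `w` is `v` or adjacent to `v`
      by_cases hwv : w = v
      · subst hwv; exact ⟨hv1, hv2⟩
      · have he'set : e' ∈ G.edgeSet := mem_edgeFinset.1 he'E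
        have heq : e' = s(w, v) := (Sym2.mem_and_mem_iff hwv).1 ⟨hw, hve'⟩
        rw [heq, mem_edgeSet] at he'set
        have h1 := supLevel_le_of_adj x₀ (hGlat w v he'set)
        have h2 := supLevel_le_of_adj x₀ (hGlat v w he'set.symm)
        constructor <;> omega
  have key := rcMeasure_real_regionCrossing_inter_regionCyl_le G ι x₀ hp hp1 hq B T hGlat U hUE
    (m := 1) (fun _ ↦ m) (fun _ ↦ hm) (fun i j hij ↦ absurd (Subsingleton.elim i j) hij)
    (fun v hv _ ↦ by
      simp only [hT, Set.mem_setOf_eq] at hv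
      rcases hv with h | h <;> rw [h] <;> omega)
    (supLevelSet ι x₀ lo) (supLevelSet ι x₀ hi)
    (fun a ha _ ↦ by rw [(mem_supLevelSet ι x₀).1 ha]; exact hlo)
    (fun b hb _ ↦ by rw [(mem_supLevelSet ι x₀).1 hb]; exact hhi)
    hc (fun _ ↦ hann) U le_rfl ξ hins
  simpa only [pow_one] using key

end NoCrossing

/-! ### Assembly: the insulated circuit from the two "no crossing" factors and the circuit -/

section Assembly

variable {V : Type*} [Fintype V] [DecidableEq V] (G : SimpleGraph V) [DecidableRel G.Adj]
  (ι : V ↪ Site 2) (x₀ : Site 2)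

omit [DecidableEq V] in
/-- `φ(A ∩ F) ≤ c φ(F)` gives `(1 - c) φ(F) ≤ φ(Aᶜ ∩ F)`. [folklore] -/
theorem one_sub_mul_le_real_compl_inter {μ : Measure (Percolation.BondConfig V)} [IsFiniteMeasure μ]
    {A F : Set (Percolation.BondConfig V)} {c : ℝ} (h : μ.real (A ∩ F) ≤ c * μ.real F) :
    (1 - c) * μ.real F ≤ μ.real (Aᶜ ∩ F) := by
  have hsplit : μ.real (F ∩ A) + μ.real (F \ A) = μ.real F :=
    measureReal_inter_add_sdiff (MeasurableSet.of_discrete (s := A))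
  rw [Set.inter_comm] at h
  rw [← Set.sdiff_eq_compl_inter]
  linarith

/-- **The insulated circuit event is not rare** (the probabilistic heart, for general `p < 1`,
`q ≥ 1`): if the wired annulus crossings of `S_{2n,4n}` and `S_{14n,28n}` have probability
`≤ c ≤ 1` and the circuit event has probability `≥ θ` under the measure of the band `[6n, 12n]`
with all other edges closed, then `φ^B_G(insulatedCircuitEvent) ≥ (1 - c)² θ`. The two "no
crossing" factors are conditional on everything off their bands
(`real_bandCross_inter_cyl_le`, `rcMeasure_real_inter_le_mul_of_cylinder_le`); the circuit is
compared with the ambient measure by monotonicity in the domain (`rcMeasure_fromEdgeSet_real_le`).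
[cite: ChelkakDuminilCopinHongler2016, §5.3, proof of Cor. 1.7] -/
theorem real_insulatedCircuitEvent_ge {p q : ℝ} (hp : p ∈ Set.Icc (0 : ℝ) 1) (hp1 : p < 1)
    (hq : 1 ≤ q) (B : Set V) (hGlat : ∀ u v : V, G.Adj u v → (zdGraph 2).Adj (ι u) (ι v))
    {n : ℕ} (hn : 1 ≤ n)
    (hB : ∀ v ∈ B, supLevel x₀ (ι v) ≤ n ∨ 29 * (n : ℤ) ≤ supLevel x₀ (ι v))
    {c : ℝ} (hc : 0 ≤ c) (hc1 : c ≤ 1)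
    (hann : ∀ m : ℕ, 1 ≤ m → (rcMeasure (finsetGraph (zdGraph 2) (squareAnnulusSites m)) p q
        (squareAnnulusInner m ∪ squareAnnulusOuter m)).real
        (openCrossing Set.univ (squareAnnulusInner m) (squareAnnulusOuter m)) ≤ c)
    {θ : ℝ}
    (hθ : θ ≤ (rcMeasure (fromEdgeSet (↑(bandEdges G ι x₀ (6 * n) (12 * n)) : Set (Sym2 V))) p q B).real
      (circuitEvent G ι x₀ n)) :
    (1 - c) ^ 2 * θ ≤ (rcMeasure G p q B).real (insulatedCircuitEvent G ι x₀ n) := by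
  classical
  have hq0 : 0 < q := one_pos.trans_le hq
  haveI := isProbabilityMeasure_rcMeasure G hp hq0 B
  set φ := rcMeasure G p q B with hφ
  set U₁ := bandEdges G ι x₀ n (5 * n) with hU₁
  set U₂ := bandEdges G ι x₀ (6 * n) (12 * n) with hU₂
  set U₃ := bandEdges G ι x₀ (13 * n) (29 * n) with hU₃
  set O := circuitEvent G ι x₀ n with hO
  set C₁ := innerCross G ι x₀ n with hC₁
  set C₃ := outerCross G ι x₀ n with hC₃
  have hU₂E : U₂ ⊆ G.edgeFinset := Finset.filter_subset _ _
  have h12 : Disjoint U₂ U₁ := (disjoint_bandEdges G ι x₀ (by omega : 5 * (n : ℤ) < 6 * n)).symm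
  have h13 : Disjoint U₃ U₁ := (disjoint_bandEdges G ι x₀ (by omega : 5 * (n : ℤ) < 13 * n)).symm
  have h23 : Disjoint U₂ U₃ := disjoint_bandEdges G ι x₀ (by omega : 12 * (n : ℤ) < 13 * n)
  -- determinedness
  have hOdet : ∀ ω₁ ω₂ : Percolation.BondConfig V, ω₁ ∩ ↑U₂ = ω₂ ∩ ↑U₂ → (ω₁ ∈ O ↔ ω₂ ∈ O) :=
    fun ω₁ ω₂ h ↦ mem_circuitEvent_iff_of_inter_eq G ι x₀ n h
  have hC₃det : ∀ ω₁ ω₂ : Percolation.BondConfig V, ω₁ ∩ ↑U₃ = ω₂ ∩ ↑U₃ → (ω₁ ∈ C₃ ↔ ω₂ ∈ C₃) :=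
    fun ω₁ ω₂ h ↦ mem_regionCrossing_iff_of_inter_eq h
  -- step 0: the circuit under the ambient measure
  have h0 : θ ≤ φ.real O := by
    refine hθ.trans ?_
    have hpos := rcMeasure_real_allClosed_pos G hp hp1 hq0 B ((↑U₂ : Set (Sym2 V))ᶜ)
    have hle := rcMeasure_fromEdgeSet_real_le G hp hq B U₂ hU₂E hpos (isUpperSet_circuitEvent G ι x₀ n)
    have hset : {ω : Percolation.BondConfig V | ω ∩ ↑U₂ ∈ O} = O := by
      ext ω
      exact hOdet _ _ (by rw [Set.inter_assoc, Set.inter_self])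
    rw [hset] at hle
    exact hle
  -- step 1: no crossing of the outer band, conditionally on the circuit
  have h1 : (1 - c) * φ.real O ≤ φ.real (C₃ᶜ ∩ O) := by
    refine one_sub_mul_le_real_compl_inter ?_
    refine rcMeasure_real_inter_le_mul_of_cylinder_le G hp hq0 B U₃
      (fun ω₁ ω₂ h ↦ determined_off_of_determined_on_disjoint h23 hOdet ω₁ ω₂ h) ?_
    intro ξ hξ
    exact real_bandCross_inter_cyl_le G ι x₀ hp hp1 hq B hGlat (m := 14 * n) (by omega)
      (by push_cast; omega) (by push_cast; omega) (fun v hv ↦ (hB v hv).imp (fun h ↦ by omega) id)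
      hc (hann (14 * n) (by omega)) ξ hξ
  -- step 2: no crossing of the inner band, conditionally on the rest
  have hFdet : ∀ ω₁ ω₂ : Percolation.BondConfig V, ω₁ ∩ (↑U₁)ᶜ = ω₂ ∩ (↑U₁)ᶜ →
      (ω₁ ∈ O ∩ C₃ᶜ ↔ ω₂ ∈ O ∩ C₃ᶜ) := by
    intro ω₁ ω₂ h
    simp only [Set.mem_inter_iff, Set.mem_compl_iff]
    rw [determined_off_of_determined_on_disjoint h12 hOdet ω₁ ω₂ h,
      determined_off_of_determined_on_disjoint h13 hC₃det ω₁ ω₂ h]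
  have h2 : (1 - c) * φ.real (O ∩ C₃ᶜ) ≤ φ.real (C₁ᶜ ∩ (O ∩ C₃ᶜ)) := by
    refine one_sub_mul_le_real_compl_inter ?_
    refine rcMeasure_real_inter_le_mul_of_cylinder_le G hp hq0 B U₁ hFdet ?_
    intro ξ hξ
    exact real_bandCross_inter_cyl_le G ι x₀ hp hp1 hq B hGlat (m := 2 * n) (by omega)
      (by push_cast; omega) (by push_cast; omega) (fun v hv ↦ (hB v hv).imp id (fun h ↦ by omega))
      hc (hann (2 * n) (by omega)) ξ hξ
  -- combine
  have h1' : (1 - c) * φ.real O ≤ φ.real (O ∩ C₃ᶜ) := by rwa [Set.inter_comm] at h1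
  have hc' : 0 ≤ 1 - c := sub_nonneg.2 hc1
  calc (1 - c) ^ 2 * θ = (1 - c) * ((1 - c) * θ) := by ring
    _ ≤ (1 - c) * ((1 - c) * φ.real O) := by gcongr
    _ ≤ (1 - c) * φ.real (O ∩ C₃ᶜ) := mul_le_mul_of_nonneg_left h1' hc'
    _ ≤ φ.real (C₁ᶜ ∩ (O ∩ C₃ᶜ)) := h2

end Assembly

/-! ### Transport: a full lattice piece inside the embedded graph -/

section Transport

variable {V : Type*} [Fintype V] [DecidableEq V] (G : SimpleGraph V) [DecidableRel G.Adj]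
  (ι : V ↪ Site 2)

/-- The edges of `G` with both endpoints over the lattice piece `S`. [folklore] -/
def edgesOver (S : Finset (Site 2)) : Finset (Sym2 V) :=
  G.edgeFinset.filter fun e ↦ ∀ v ∈ e, ι v ∈ S

/-- The vertices over `S` satisfying a predicate on their position. [folklore] -/
def verticesOver (S : Finset (Site 2)) (P : Site 2 → Prop) [DecidablePred P] : Finset V :=
  Finset.univ.filter fun v ↦ ι v ∈ S ∧ P (ι v)

variable {G ι}

/-- Membership in `edgesOver`. [folklore] -/
theorem mem_edgesOver {S : Finset (Site 2)} {e : Sym2 V} :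
    e ∈ edgesOver G ι S ↔ e ∈ G.edgeFinset ∧ ∀ v ∈ e, ι v ∈ S := by
  rw [edgesOver, Finset.mem_filter]

omit [DecidableEq V] in
/-- Membership in `verticesOver`. [folklore] -/
theorem mem_verticesOver {S : Finset (Site 2)} {P : Site 2 → Prop} [DecidablePred P] {v : V} :
    v ∈ verticesOver ι S P ↔ ι v ∈ S ∧ P (ι v) := by
  rw [verticesOver, Finset.mem_filter]
  simp only [Finset.mem_univ, true_and]

/-- **The measure of a full lattice piece inside an embedded graph is the measure of the piece.**
Let the edges of `G` be lattice edges under `ι : V ↪ ℤ²`, let every site of the finite set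
`S ⊆ ℤ²` be covered by `ι` and every lattice edge between covered sites of `S` be an edge of `G`.
Then the random-cluster measure, with free boundary conditions, of the spanning graph of `V`
with the edges over `S` gives to a crossing between positions `P` and `Q` by open edges over `S`
the probability that the lattice piece `S` (`finsetGraph (zdGraph 2) S`) gives to an open
crossing between `{P}` and `{Q}` (`rcMeasure_real_map_image`: the other vertices are isolated).
[cite: Grimmett2006, §4.2 and Lemma (4.13)] -/
theorem rcMeasure_edgesOver_real_regionCrossing_eq {p q : ℝ} (hp : p ∈ Set.Icc (0 : ℝ) 1)
    (hq : 0 < q) (hGlat : ∀ u v : V, G.Adj u v → (zdGraph 2).Adj (ι u) (ι v))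
    {S : Finset (Site 2)} (hfill : ∀ z ∈ S, ∃ v, ι v = z)
    (hadj : ∀ u v : V, ι u ∈ S → ι v ∈ S → (zdGraph 2).Adj (ι u) (ι v) → G.Adj u v)
    (P Q : Site 2 → Prop) [DecidablePred P] [DecidablePred Q] :
    (rcMeasure (fromEdgeSet (↑(edgesOver G ι S) : Set (Sym2 V))) p q ∅).real
        (regionCrossing (edgesOver G ι S) (verticesOver ι S P) (verticesOver ι S Q)) =
      (rcMeasure (finsetGraph (zdGraph 2) S) p q ∅).real
        (openCrossing Set.univ {x | P x.1} {x | Q x.1}) := by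
  classical
  set E := edgesOver G ι S with hEdef
  -- the lift `j : S ↪ V`
  have hch : ∀ z : ↥S, ∃ v, ι v = z.1 := fun z ↦ hfill z.1 z.2
  choose jf hjf using hch
  have hjinj : Function.Injective jf := by
    intro z₁ z₂ h
    apply Subtype.ext
    rw [← hjf z₁, ← hjf z₂, h]
  set j : ↥S ↪ V := ⟨jf, hjinj⟩ with hj
  have hjι : ∀ z : ↥S, ι (j z) = z.1 := hjf
  have hj_of_eq : ∀ (z : ↥S) (v : V), ι v = z.1 → j z = v := fun z v hv ↦
    ι.injective ((hjι z).trans hv.symm)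
  -- the edge sets correspond
  have hEnd : ∀ e ∈ E, ¬ e.IsDiag := fun e he ↦
    G.not_isDiag_of_mem_edgeSet (mem_edgeFinset.1 (mem_edgesOver.1 he).1)
  have hEE : @edgeFinset V (fromEdgeSet (↑E : Set (Sym2 V))) (fromEdgeSet (↑E : Set (Sym2 V))).fintypeEdgeSet = E :=
    @edgeFinset_fromEdgeSet_of_forall_not_isDiag V _ E hEnd (fromEdgeSet (↑E : Set (Sym2 V))).fintypeEdgeSet
  have hE : @edgeFinset V (fromEdgeSet (↑E : Set (Sym2 V))) (fromEdgeSet (↑E : Set (Sym2 V))).fintypeEdgeSet =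
      (finsetGraph (zdGraph 2) S).edgeFinset.map j.sym2Map := by
    rw [hEE]
    ext e
    rw [Finset.mem_map]
    constructor
    · intro he
      obtain ⟨heG, hS⟩ := mem_edgesOver.1 he
      induction e using Sym2.ind with
      | h u v =>
        have huv : G.Adj u v := mem_edgeFinset.1 heG
        have hu : ι u ∈ S := hS u (Sym2.mem_mk_left u v)
        have hv : ι v ∈ S := hS v (Sym2.mem_mk_right u v)
        refine ⟨s(⟨ι u, hu⟩, ⟨ι v, hv⟩), ?_, ?_⟩
        · rw [mem_edgeFinset, mem_edgeSet]
          exact hGlat u v huv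
        · rw [Function.Embedding.sym2Map_apply, Sym2.map_mk, hj_of_eq ⟨ι u, hu⟩ u rfl,
            hj_of_eq ⟨ι v, hv⟩ v rfl]
    · rintro ⟨e₀, he₀, rfl⟩
      induction e₀ using Sym2.ind with
      | h x y =>
        rw [mem_edgeFinset, mem_edgeSet] at he₀
        have hadj' : G.Adj (j x) (j y) :=
          hadj _ _ (by rw [hjι]; exact x.2) (by rw [hjι]; exact y.2) (by rw [hjι, hjι]; exact he₀)
        rw [Function.Embedding.sym2Map_apply, Sym2.map_mk, mem_edgesOver, mem_edgeFinset]
        refine ⟨hadj', fun w hw ↦ ?_⟩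
        rcases Sym2.mem_iff.1 hw with rfl | rfl
        · rw [hjι]; exact x.2
        · rw [hjι]; exact y.2
  -- the vertex sets correspond
  have hIn : ∀ (R : Site 2 → Prop) [DecidablePred R],
      (↑(verticesOver ι S R) : Set V) = j '' {x : ↥S | R x.1} := by
    intro R _
    ext v
    rw [Finset.mem_coe, mem_verticesOver, Set.mem_image]
    constructor
    · rintro ⟨hvS, hRv⟩
      exact ⟨⟨ι v, hvS⟩, hRv, hj_of_eq ⟨ι v, hvS⟩ v rfl⟩
    · rintro ⟨x, hx, rfl⟩
      rw [Set.mem_setOf_eq] at hx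
      rw [hjι]
      exact ⟨x.2, hx⟩
  -- transport
  have key : (rcMeasure (fromEdgeSet (↑E : Set (Sym2 V))) p q (j '' ∅)).real
      (regionCrossing E (verticesOver ι S P) (verticesOver ι S Q)) =
      (rcMeasure (finsetGraph (zdGraph 2) S) p q ∅).real
        (openCrossing Set.univ {x | P x.1} {x | Q x.1}) := by
    refine rcMeasure_real_map_image j hE hp hq ∅ fun ω hω ↦ ?_
    rw [mem_openCrossing_univ_iff, exists_reachable_map_iff j ω]
    -- the region graph of the mapped configuration is its open graph
    have hωE' : ω.map j.sym2Map ⊆ E := by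
      rw [← hEE, hE]
      exact Finset.map_subset_map.2 hω
    have hωE : (↑(ω.map j.sym2Map) : Set (Sym2 V)) ⊆ ↑E := Finset.coe_subset.2 hωE'
    have hreg : regionGraph E (↑(ω.map j.sym2Map) : Percolation.BondConfig V) =
        openGraph (↑(ω.map j.sym2Map) : Percolation.BondConfig V) := by
      rw [regionGraph, Set.inter_eq_left.2 hωE]
    simp only [regionCrossing, Set.mem_setOf_eq, hreg, ← Finset.mem_coe, hIn]
  rwa [Set.image_empty] at key

end Transport

/-! ### The circuit at criticality: DCS Theorem 3.16 in the four rectangles -/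

section Circuit

variable {V : Type*} [Fintype V] [DecidableEq V] (G : SimpleGraph V) [DecidableRel G.Adj]
  (ι : V ↪ Site 2) (x₀ : Site 2)

/-- The lattice rectangle `(i, ε)` at scale `n` around `x₀`, as a finite set of sites. [cite: DuminilCopinSmirnov2012Clay, proof of Lemma 6.3] -/
def rectSites (n : ℕ) (i : Fin 2) (ε : ℤˣ) : Finset (Site 2) :=
  (Finset.Icc (x₀ - ![12 * (n : ℤ), 12 * n]) (x₀ + ![12 * (n : ℤ), 12 * n])).filter
    fun z ↦ InRect n i ε (z - x₀)

variable {x₀} in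
/-- Membership in `rectSites`. [folklore] -/
theorem mem_rectSites {n : ℕ} {i : Fin 2} {ε : ℤˣ} {z : Site 2} :
    z ∈ rectSites x₀ n i ε ↔ InRect n i ε (z - x₀) := by
  rw [rectSites, Finset.mem_filter, and_iff_right_iff_imp]
  intro h
  obtain ⟨h1, h2, h3⟩ := h
  have hi : |(z - x₀) i| ≤ 12 * n := by
    rcases Int.units_eq_one_or ε with rfl | rfl
    · simp only [Units.val_one, one_mul] at h1 h2; rw [abs_le]; constructor <;> omega
    · simp only [Units.val_neg, Units.val_one, neg_mul, one_mul] at h1 h2; rw [abs_le]; constructor <;> omega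
  have h0 : |(z - x₀) 0| ≤ 12 * n := by fin_cases i; exacts [hi, h3]
  have h1' : |(z - x₀) 1| ≤ 12 * n := by fin_cases i; exacts [h3, hi]
  simp only [Pi.sub_apply] at h0 h1'
  rw [abs_le] at h0 h1'
  rw [Finset.mem_Icc, Pi.le_def, Pi.le_def, Fin.forall_fin_two, Fin.forall_fin_two]
  simp only [Pi.sub_apply, Pi.add_apply, Matrix.cons_val_zero, Matrix.cons_val_one]
  omega

/-- The rectangle edges are the edges over the rectangle sites. [folklore] -/
theorem rectEdges_eq_edgesOver (n : ℕ) (i : Fin 2) (ε : ℤˣ) :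
    rectEdges G ι x₀ n i ε = edgesOver G ι (rectSites x₀ n i ε) := by
  unfold rectEdges edgesOver
  congr 1
  ext e
  simp only [mem_rectSites]

omit [DecidableEq V] in
/-- The short sides are the vertices over the rectangle sites on the lines `y_{1-i} = ∓12n`. [folklore] -/
theorem rectIn_eq_verticesOver (n : ℕ) (i : Fin 2) (ε : ℤˣ) :
    rectIn ι x₀ n i ε = verticesOver ι (rectSites x₀ n i ε) (fun z ↦ (z - x₀) i.rev = -(12 * n)) := by
  unfold rectIn verticesOver
  congr 1
  ext v
  simp only [mem_rectSites]

omit [DecidableEq V] in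
/-- See `rectIn_eq_verticesOver`. [folklore] -/
theorem rectOut_eq_verticesOver (n : ℕ) (i : Fin 2) (ε : ℤˣ) :
    rectOut ι x₀ n i ε = verticesOver ι (rectSites x₀ n i ε) (fun z ↦ (z - x₀) i.rev = 12 * n) := by
  unfold rectOut verticesOver
  congr 1
  ext v
  simp only [mem_rectSites]

end Circuit

/-! ### The circuit at criticality -/

section Critical

variable {V : Type*} [Fintype V] [DecidableEq V] (G : SimpleGraph V) [DecidableRel G.Adj]
  (ι : V ↪ Site 2) (x₀ : Site 2)

/-- A site of the rectangle `(i, ε)` has sup-norm level in `[6n, 12n]`. [folklore] -/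
theorem supLevel_mem_of_inRect {n : ℕ} {i : Fin 2} {ε : ℤˣ} {z : Site 2} (h : InRect n i ε (z - x₀)) :
    6 * (n : ℤ) ≤ supLevel x₀ z ∧ supLevel x₀ z ≤ 12 * n := by
  obtain ⟨h1, h2, h3⟩ := h
  have hle := units_mul_le_max_abs (z - x₀) i ε
  unfold supLevel
  refine ⟨h1.trans hle, ?_⟩
  have hi : |(z - x₀) i| ≤ 12 * n := by
    rcases Int.units_eq_one_or ε with rfl | rfl
    · simp only [Units.val_one, one_mul] at h1 h2; rw [abs_le]; constructor <;> omega
    · simp only [Units.val_neg, Units.val_one, neg_mul, one_mul] at h1 h2; rw [abs_le]; constructor <;> omega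
  fin_cases i
  · exact max_le hi (by simpa using h3)
  · exact max_le (by simpa using h3) hi

/-- The circuit event as an intersection of the four rectangle crossings. [folklore] -/
theorem circuitEvent_eq_inter (n : ℕ) :
    circuitEvent G ι x₀ n = rectCross G ι x₀ n 0 1 ∩ (rectCross G ι x₀ n 0 (-1) ∩
      (rectCross G ι x₀ n 1 1 ∩ rectCross G ι x₀ n 1 (-1))) := by
  ext ω
  simp only [circuitEvent, Set.mem_iInter, Set.mem_inter_iff, Fin.forall_fin_two]
  constructor
  · intro h
    exact ⟨h.1 1, h.1 (-1), h.2 1, h.2 (-1)⟩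
  · rintro ⟨h1, h2, h3, h4⟩
    refine ⟨fun ε ↦ ?_, fun ε ↦ ?_⟩ <;> rcases Int.units_eq_one_or ε with rfl | rfl <;> assumption

/-- `p_sd(2) < 1` (local copy of `criticalFKIsingParam_lt_one` of
`FKIsingInterfaceTightnessProofs.lean`, not imported here). [cite: DuminilCopinSmirnov2012Clay, §3.2] -/
private theorem criticalFKIsingParam_lt_one' : criticalFKIsingParam < 1 := by
  unfold criticalFKIsingParam
  have h : (0 : ℝ) < 1 + Real.sqrt 2 := by positivity
  rw [div_lt_one h]
  linarith

/-- **One rectangle**: under the free measure of the band `[6n, 12n]` (all other edges closed),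
the long-way crossing of the rectangle `(i, ε)` has probability at least that of the long-way
crossing of the standalone `24n × 6n` lattice rectangle (monotonicity in the domain for free
boundary conditions, `rcMeasure_fromEdgeSet_real_le`, and the transport
`rcMeasure_edgesOver_real_regionCrossing_eq`). [cite: Grimmett2006, Lemma (4.14)] -/
theorem fkIsingFiniteMeasure_rect_le_real_rectCross
    (hGlat : ∀ u v : V, G.Adj u v → (zdGraph 2).Adj (ι u) (ι v)) {n : ℕ}
    (hfill : ∀ z : Site 2, 6 * (n : ℤ) ≤ supLevel x₀ z → supLevel x₀ z ≤ 12 * n → ∃ v, ι v = z)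
    (hadj : ∀ u v : V, 6 * (n : ℤ) ≤ supLevel x₀ (ι u) → supLevel x₀ (ι u) ≤ 12 * n →
      6 * (n : ℤ) ≤ supLevel x₀ (ι v) → supLevel x₀ (ι v) ≤ 12 * n →
      (zdGraph 2).Adj (ι u) (ι v) → G.Adj u v)
    (i : Fin 2) (ε : ℤˣ) :
    (fkIsingFiniteMeasure (rectSites x₀ n i ε) ∅).real
        (openCrossing Set.univ {x | (x.1 - x₀) i.rev = -(12 * n)} {x | (x.1 - x₀) i.rev = 12 * n}) ≤
      (rcMeasure (fromEdgeSet (↑(bandEdges G ι x₀ (6 * n) (12 * n)) : Set (Sym2 V)))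
        criticalFKIsingParam 2 ∅).real (rectCross G ι x₀ n i ε) := by
  classical
  have hp := criticalFKIsingParam_mem_Icc
  set U₂ := bandEdges G ι x₀ (6 * n) (12 * n) with hU₂
  set S := rectSites x₀ n i ε with hS
  have hU₂nd : ∀ e ∈ U₂, ¬ e.IsDiag := fun e he ↦
    G.not_isDiag_of_mem_edgeSet (mem_edgeFinset.1 (mem_bandEdges.1 he).1)
  have hEU : @edgeFinset V (fromEdgeSet (↑U₂ : Set (Sym2 V))) (fromEdgeSet (↑U₂ : Set (Sym2 V))).fintypeEdgeSet = U₂ :=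
    @edgeFinset_fromEdgeSet_of_forall_not_isDiag V _ U₂ hU₂nd (fromEdgeSet (↑U₂ : Set (Sym2 V))).fintypeEdgeSet
  have hsub : rectEdges G ι x₀ n i ε ⊆
      @edgeFinset V (fromEdgeSet (↑U₂ : Set (Sym2 V))) (fromEdgeSet (↑U₂ : Set (Sym2 V))).fintypeEdgeSet := by
    rw [hEU]; exact rectEdges_subset_bandEdges G ι x₀ n i ε
  have h0 := rcMeasure_real_allClosed_pos (fromEdgeSet (↑U₂ : Set (Sym2 V))) hp
    criticalFKIsingParam_lt_one' two_pos ∅ ((↑(rectEdges G ι x₀ n i ε) : Set (Sym2 V))ᶜ)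
  have hmono := rcMeasure_fromEdgeSet_real_le (fromEdgeSet (↑U₂ : Set (Sym2 V))) hp
    (by norm_num : (1 : ℝ) ≤ 2) ∅ (rectEdges G ι x₀ n i ε) hsub h0
    (isUpperSet_regionCrossing (rectEdges G ι x₀ n i ε) (rectIn ι x₀ n i ε) (rectOut ι x₀ n i ε))
  rw [setOf_inter_mem_regionCrossing] at hmono
  refine le_trans (le_of_eq ?_) hmono
  -- the rectangle piece
  have hfillS : ∀ z ∈ S, ∃ v, ι v = z := fun z hz ↦ by
    have h := supLevel_mem_of_inRect x₀ (mem_rectSites.1 hz)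
    exact hfill z h.1 h.2
  have hadjS : ∀ u v : V, ι u ∈ S → ι v ∈ S → (zdGraph 2).Adj (ι u) (ι v) → G.Adj u v := by
    intro u v hu hv huv
    have hu' := supLevel_mem_of_inRect x₀ (mem_rectSites.1 hu)
    have hv' := supLevel_mem_of_inRect x₀ (mem_rectSites.1 hv)
    exact hadj u v hu'.1 hu'.2 hv'.1 hv'.2 huv
  rw [rectEdges_eq_edgesOver, rectIn_eq_verticesOver, rectOut_eq_verticesOver,
    rcMeasure_edgesOver_real_regionCrossing_eq hp two_pos hGlat hfillS hadjS,
    fkIsingFiniteMeasure_eq_finsetGraph]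
  rfl

end Critical

/-! ### The four rectangles and the final bound -/

section Final

variable {V : Type*} [Fintype V] [DecidableEq V] (G : SimpleGraph V) [DecidableRel G.Adj]
  (ι : V ↪ Site 2) (x₀ : Site 2)

/-- `Fin.rev` on `Fin 2` (local copy of `AEdge.rev_zero`). [folklore] -/
private theorem fin_rev_zero : (0 : Fin 2).rev = 1 := by decide

/-- `Fin.rev` on `Fin 2` (local copy of `AEdge.rev_one`). [folklore] -/
private theorem fin_rev_one : (1 : Fin 2).rev = 0 := by decide

/-- **DCS Theorem 3.16 in each of the four rectangles of `S_{6n,12n}`**: with `c₁` the constant of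
`fkIsing_rsw.shift` (translated `4m × m` rectangles, left-to-right) and `c₂` that of
`fkIsing_rsw.transpose_shift` (translated `m × 4m` rectangles, bottom-to-top), each long-way
crossing `rectCross n i ε` has probability `≥ min c₁ c₂` under the free measure of the band
`[6n, 12n]`. [cite: DuminilCopinSmirnov2012Clay, Thm. 3.16 and proof of Lemma 6.3] -/
theorem min_le_real_rectCross {c₁ c₂ : ℝ}
    (hc₁ : ∀ m : ℕ, 1 ≤ m → ∀ (v : Site 2) (S' : Finset (Site 2)),
      (∀ x, x ∈ S' ↔ x - v ∈ rectangle (4 * m) m) →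
      c₁ ≤ (fkIsingFiniteMeasure S' ∅).real
        (openCrossing Set.univ {x | x.1 0 = v 0} {x | x.1 0 = v 0 + 4 * m}))
    (hc₂ : ∀ m : ℕ, 1 ≤ m → ∀ (v : Site 2) (S' : Finset (Site 2)),
      (∀ x, x ∈ S' ↔ (![x 1 - v 1, x 0 - v 0] : Site 2) ∈ rectangle (4 * m) m) →
      c₂ ≤ (fkIsingFiniteMeasure S' ∅).real
        (openCrossing Set.univ {x | x.1 1 = v 1} {x | x.1 1 = v 1 + 4 * m}))
    (hGlat : ∀ u v : V, G.Adj u v → (zdGraph 2).Adj (ι u) (ι v)) {n : ℕ} (hn : 1 ≤ n)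
    (hfill : ∀ z : Site 2, 6 * (n : ℤ) ≤ supLevel x₀ z → supLevel x₀ z ≤ 12 * n → ∃ v, ι v = z)
    (hadj : ∀ u v : V, 6 * (n : ℤ) ≤ supLevel x₀ (ι u) → supLevel x₀ (ι u) ≤ 12 * n →
      6 * (n : ℤ) ≤ supLevel x₀ (ι v) → supLevel x₀ (ι v) ≤ 12 * n →
      (zdGraph 2).Adj (ι u) (ι v) → G.Adj u v)
    (i : Fin 2) (ε : ℤˣ) :
    min c₁ c₂ ≤ (rcMeasure (fromEdgeSet (↑(bandEdges G ι x₀ (6 * n) (12 * n)) : Set (Sym2 V)))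
        criticalFKIsingParam 2 ∅).real (rectCross G ι x₀ n i ε) := by
  refine le_trans ?_ (fkIsingFiniteMeasure_rect_le_real_rectCross G ι x₀ hGlat hfill hadj i ε)
  have hm : 1 ≤ 6 * n := by omega
  have hi : i = 0 ∨ i = 1 := by fin_cases i <;> simp
  rcases hi with rfl | rfl <;> rcases Int.units_eq_one_or ε with rfl | rfl <;>
    set S' := rectSites x₀ n _ _ with hS'
  · -- right rectangle `6n ≤ y₀ ≤ 12n`: transposed, `v = x₀ + (6n, -12n)`
    set v : Site 2 := x₀ + ![6 * (n : ℤ), -(12 * n)] with hv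
    have hmem : ∀ x, x ∈ S' ↔ (![x 1 - v 1, x 0 - v 0] : Site 2) ∈ rectangle (4 * (6 * n)) (6 * n) := by
      intro x
      rw [hS', mem_rectSites, InRect, mem_rectangle_iff, fin_rev_zero]
      simp only [hv, Units.val_one, one_mul, Pi.sub_apply, Pi.add_apply, Matrix.cons_val_zero,
        Matrix.cons_val_one, abs_le]
      push_cast
      omega
    refine (min_le_right _ _).trans ((hc₂ (6 * n) hm v S' hmem).trans (le_of_eq ?_))
    simp only [fin_rev_zero]
    congr 2
    · ext x; simp only [Set.mem_setOf_eq, hv, Pi.sub_apply, Pi.add_apply, Matrix.cons_val_one,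
        Matrix.cons_val_zero]; omega
    · ext x; simp only [Set.mem_setOf_eq, hv, Pi.sub_apply, Pi.add_apply, Matrix.cons_val_one,
        Matrix.cons_val_zero]
      push_cast; omega
  · -- left rectangle `-12n ≤ y₀ ≤ -6n`: transposed, `v = x₀ + (-12n, -12n)`
    set v : Site 2 := x₀ + ![-(12 * (n : ℤ)), -(12 * n)] with hv
    have hmem : ∀ x, x ∈ S' ↔ (![x 1 - v 1, x 0 - v 0] : Site 2) ∈ rectangle (4 * (6 * n)) (6 * n) := by
      intro x
      rw [hS', mem_rectSites, InRect, mem_rectangle_iff, fin_rev_zero]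
      simp only [hv, Units.val_neg, Units.val_one, neg_mul, one_mul, Pi.sub_apply, Pi.add_apply,
        Matrix.cons_val_zero, Matrix.cons_val_one, abs_le]
      push_cast
      omega
    refine (min_le_right _ _).trans ((hc₂ (6 * n) hm v S' hmem).trans (le_of_eq ?_))
    simp only [fin_rev_zero]
    congr 2
    · ext x; simp only [Set.mem_setOf_eq, hv, Pi.sub_apply, Pi.add_apply, Matrix.cons_val_one,
        Matrix.cons_val_zero]; omega
    · ext x; simp only [Set.mem_setOf_eq, hv, Pi.sub_apply, Pi.add_apply, Matrix.cons_val_one,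
        Matrix.cons_val_zero]
      push_cast; omega
  · -- top rectangle `6n ≤ y₁ ≤ 12n`: `v = x₀ + (-12n, 6n)`
    set v : Site 2 := x₀ + ![-(12 * (n : ℤ)), 6 * n] with hv
    have hmem : ∀ x, x ∈ S' ↔ x - v ∈ rectangle (4 * (6 * n)) (6 * n) := by
      intro x
      rw [hS', mem_rectSites, InRect, mem_rectangle_iff, fin_rev_one]
      simp only [hv, Units.val_one, one_mul, Pi.sub_apply, Pi.add_apply, Matrix.cons_val_zero,
        Matrix.cons_val_one, abs_le]
      push_cast
      omega
    refine (min_le_left _ _).trans ((hc₁ (6 * n) hm v S' hmem).trans (le_of_eq ?_))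
    simp only [fin_rev_one]
    congr 2
    · ext x; simp only [Set.mem_setOf_eq, hv, Pi.sub_apply, Pi.add_apply, Matrix.cons_val_zero]; omega
    · ext x; simp only [Set.mem_setOf_eq, hv, Pi.sub_apply, Pi.add_apply, Matrix.cons_val_zero]
      push_cast; omega
  · -- bottom rectangle `-12n ≤ y₁ ≤ -6n`: `v = x₀ + (-12n, -12n)`
    set v : Site 2 := x₀ + ![-(12 * (n : ℤ)), -(12 * n)] with hv
    have hmem : ∀ x, x ∈ S' ↔ x - v ∈ rectangle (4 * (6 * n)) (6 * n) := by
      intro x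
      rw [hS', mem_rectSites, InRect, mem_rectangle_iff, fin_rev_one]
      simp only [hv, Units.val_neg, Units.val_one, neg_mul, one_mul, Pi.sub_apply, Pi.add_apply,
        Matrix.cons_val_zero, Matrix.cons_val_one, abs_le]
      push_cast
      omega
    refine (min_le_left _ _).trans ((hc₁ (6 * n) hm v S' hmem).trans (le_of_eq ?_))
    simp only [fin_rev_one]
    congr 2
    · ext x; simp only [Set.mem_setOf_eq, hv, Pi.sub_apply, Pi.add_apply, Matrix.cons_val_zero]; omega
    · ext x; simp only [Set.mem_setOf_eq, hv, Pi.sub_apply, Pi.add_apply, Matrix.cons_val_zero]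
      push_cast; omega

/-- **The circuit event under the measure of the band with all other edges closed**
("the FKG inequality implies that the probability of a circuit is larger than `c₁⁴`", DCS 2012,
proof of Lemma 6.3, here for open long-way crossings of the four `24n × 6n` rectangles under free
boundary conditions): `≥ (min c₁ c₂)⁴`, whatever the wired set `B` at levels `≤ n` or `≥ 29n`
(its vertices are isolated in the band, `rcMeasure_real_union_isolated`).
[cite: DuminilCopinSmirnov2012Clay, proof of Lemma 6.3] -/
theorem pow_four_le_real_circuitEvent {c₁ c₂ : ℝ} (hm0 : 0 ≤ min c₁ c₂)
    (hc₁ : ∀ m : ℕ, 1 ≤ m → ∀ (v : Site 2) (S' : Finset (Site 2)),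
      (∀ x, x ∈ S' ↔ x - v ∈ rectangle (4 * m) m) →
      c₁ ≤ (fkIsingFiniteMeasure S' ∅).real
        (openCrossing Set.univ {x | x.1 0 = v 0} {x | x.1 0 = v 0 + 4 * m}))
    (hc₂ : ∀ m : ℕ, 1 ≤ m → ∀ (v : Site 2) (S' : Finset (Site 2)),
      (∀ x, x ∈ S' ↔ (![x 1 - v 1, x 0 - v 0] : Site 2) ∈ rectangle (4 * m) m) →
      c₂ ≤ (fkIsingFiniteMeasure S' ∅).real
        (openCrossing Set.univ {x | x.1 1 = v 1} {x | x.1 1 = v 1 + 4 * m}))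
    (hGlat : ∀ u v : V, G.Adj u v → (zdGraph 2).Adj (ι u) (ι v)) {n : ℕ} (hn : 1 ≤ n)
    (hfill : ∀ z : Site 2, 6 * (n : ℤ) ≤ supLevel x₀ z → supLevel x₀ z ≤ 12 * n → ∃ v, ι v = z)
    (hadj : ∀ u v : V, 6 * (n : ℤ) ≤ supLevel x₀ (ι u) → supLevel x₀ (ι u) ≤ 12 * n →
      6 * (n : ℤ) ≤ supLevel x₀ (ι v) → supLevel x₀ (ι v) ≤ 12 * n →
      (zdGraph 2).Adj (ι u) (ι v) → G.Adj u v)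
    (B : Set V) (hB : ∀ v ∈ B, supLevel x₀ (ι v) ≤ n ∨ 29 * (n : ℤ) ≤ supLevel x₀ (ι v)) :
    (min c₁ c₂) ^ 4 ≤ (rcMeasure (fromEdgeSet (↑(bandEdges G ι x₀ (6 * n) (12 * n)) : Set (Sym2 V)))
        criticalFKIsingParam 2 B).real (circuitEvent G ι x₀ n) := by
  classical
  have hp := criticalFKIsingParam_mem_Icc
  have h12 : (1 : ℝ) ≤ 2 := by norm_num
  set U₂ := bandEdges G ι x₀ (6 * n) (12 * n) with hU₂
  -- the wired vertices are isolated in the band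
  have hBfin : B.Finite := Set.toFinite B
  have hiso : ∀ v ∈ hBfin.toFinset, ∀ w, ¬ (fromEdgeSet (↑U₂ : Set (Sym2 V))).Adj v w := by
    intro v hv w hvw
    rw [Set.Finite.mem_toFinset] at hv
    rw [fromEdgeSet_adj, Finset.mem_coe, mem_bandEdges] at hvw
    have hlev := hvw.1.2 v (Sym2.mem_mk_left v w)
    rcases hB v hv with h | h <;> omega
  have hdrop := rcMeasure_real_union_isolated (fromEdgeSet (↑U₂ : Set (Sym2 V))) hp two_pos ∅
    hBfin.toFinset hiso (circuitEvent G ι x₀ n)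
  rw [Set.Finite.coe_toFinset, Set.empty_union] at hdrop
  rw [hdrop]
  -- FKG for the four increasing crossings
  set ψ := rcMeasure (fromEdgeSet (↑U₂ : Set (Sym2 V))) criticalFKIsingParam 2 ∅ with hψ
  have hR : ∀ (i : Fin 2) (ε : ℤˣ), min c₁ c₂ ≤ ψ.real (rectCross G ι x₀ n i ε) := fun i ε ↦
    min_le_real_rectCross G ι x₀ hc₁ hc₂ hGlat hn hfill hadj i ε
  have hU : ∀ (i : Fin 2) (ε : ℤˣ), IsUpperSet (rectCross G ι x₀ n i ε) := fun i ε ↦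
    isUpperSet_regionCrossing _ _ _
  have fkg : ∀ {A A' : Set (Percolation.BondConfig V)}, IsUpperSet A → IsUpperSet A' →
      ψ.real A * ψ.real A' ≤ ψ.real (A ∩ A') := fun hA hA' ↦
    rcMeasure_fkg_holds (fromEdgeSet (↑U₂ : Set (Sym2 V))) hp h12 ∅ hA hA'
  set m := min c₁ c₂ with hm
  rw [circuitEvent_eq_inter]
  have h4 : m * m ≤ ψ.real (rectCross G ι x₀ n 1 1) * ψ.real (rectCross G ι x₀ n 1 (-1)) :=
    mul_le_mul (hR 1 1) (hR 1 (-1)) hm0 measureReal_nonneg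
  have h3 : m * (m * m) ≤ ψ.real (rectCross G ι x₀ n 0 (-1)) *
      (ψ.real (rectCross G ι x₀ n 1 1) * ψ.real (rectCross G ι x₀ n 1 (-1))) :=
    mul_le_mul (hR 0 (-1)) h4 (mul_nonneg hm0 hm0) measureReal_nonneg
  have h2 : m * (m * (m * m)) ≤ ψ.real (rectCross G ι x₀ n 0 1) * (ψ.real (rectCross G ι x₀ n 0 (-1)) *
      (ψ.real (rectCross G ι x₀ n 1 1) * ψ.real (rectCross G ι x₀ n 1 (-1)))) :=
    mul_le_mul (hR 0 1) h3 (mul_nonneg hm0 (mul_nonneg hm0 hm0)) measureReal_nonneg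
  calc m ^ 4 = m * (m * (m * m)) := by ring
    _ ≤ _ := h2
    _ ≤ ψ.real (rectCross G ι x₀ n 0 1) * (ψ.real (rectCross G ι x₀ n 0 (-1)) *
        ψ.real (rectCross G ι x₀ n 1 1 ∩ rectCross G ι x₀ n 1 (-1))) :=
      mul_le_mul_of_nonneg_left (mul_le_mul_of_nonneg_left (fkg (hU 1 1) (hU 1 (-1))) measureReal_nonneg)
        measureReal_nonneg
    _ ≤ ψ.real (rectCross G ι x₀ n 0 1) * ψ.real (rectCross G ι x₀ n 0 (-1) ∩
        (rectCross G ι x₀ n 1 1 ∩ rectCross G ι x₀ n 1 (-1))) :=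
      mul_le_mul_of_nonneg_left (fkg (hU 0 (-1)) ((hU 1 1).inter (hU 1 (-1)))) measureReal_nonneg
    _ ≤ _ := fkg (hU 0 1) ((hU 0 (-1)).inter ((hU 1 1).inter (hU 1 (-1))))

/-- **An insulated open circuit is not rare, uniformly** (the FK-side input of the transfer of
RSW to the spin model; Chelkak–Duminil-Copin–Hongler 2016, §5.3, with Duminil-Copin–Smirnov 2012,
Thm. 3.16 and Lemma 6.3 as the crossing inputs). Let `c ∈ [0, 1]` bound the wired annulus
crossing probabilities of all `S_{m,2m}`, `m ≥ 1` (the conclusion of `fkIsing_annulusCrossing_le`),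
and `c₁, c₂` be RSW constants for translated and transposed `4m × m` rectangles (the conclusions
of `fkIsing_rsw.shift`, `fkIsing_rsw.transpose_shift`). Then for every finite graph `G` with
lattice edges under `ι : V ↪ ℤ²`, containing the full lattice annulus `x₀ + S_{6n,12n}`
(`n ≥ 1`), and every wired set `B` at levels `≤ n` or `≥ 29n`,
`φ^B_{G,p_sd,2}(insulatedCircuitEvent n) ≥ (1 - c)² (min c₁ c₂)⁴`.
[cite: ChelkakDuminilCopinHongler2016, §5.3, proof of Cor. 1.7] -/
theorem le_rcMeasure_real_insulatedCircuitEvent {c c₁ c₂ : ℝ} (hc0 : 0 ≤ c) (hc1 : c ≤ 1)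
    (hann : ∀ m : ℕ, 1 ≤ m → (fkIsingFiniteMeasure (squareAnnulusSites m)
      (squareAnnulusInner m ∪ squareAnnulusOuter m)).real
      (openCrossing Set.univ (squareAnnulusInner m) (squareAnnulusOuter m)) ≤ c)
    (hm0 : 0 ≤ min c₁ c₂)
    (hc₁ : ∀ m : ℕ, 1 ≤ m → ∀ (v : Site 2) (S' : Finset (Site 2)),
      (∀ x, x ∈ S' ↔ x - v ∈ rectangle (4 * m) m) →
      c₁ ≤ (fkIsingFiniteMeasure S' ∅).real
        (openCrossing Set.univ {x | x.1 0 = v 0} {x | x.1 0 = v 0 + 4 * m}))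
    (hc₂ : ∀ m : ℕ, 1 ≤ m → ∀ (v : Site 2) (S' : Finset (Site 2)),
      (∀ x, x ∈ S' ↔ (![x 1 - v 1, x 0 - v 0] : Site 2) ∈ rectangle (4 * m) m) →
      c₂ ≤ (fkIsingFiniteMeasure S' ∅).real
        (openCrossing Set.univ {x | x.1 1 = v 1} {x | x.1 1 = v 1 + 4 * m}))
    (hGlat : ∀ u v : V, G.Adj u v → (zdGraph 2).Adj (ι u) (ι v)) {n : ℕ} (hn : 1 ≤ n)
    (hfill : ∀ z : Site 2, 6 * (n : ℤ) ≤ supLevel x₀ z → supLevel x₀ z ≤ 12 * n → ∃ v, ι v = z)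
    (hadj : ∀ u v : V, 6 * (n : ℤ) ≤ supLevel x₀ (ι u) → supLevel x₀ (ι u) ≤ 12 * n →
      6 * (n : ℤ) ≤ supLevel x₀ (ι v) → supLevel x₀ (ι v) ≤ 12 * n →
      (zdGraph 2).Adj (ι u) (ι v) → G.Adj u v)
    (B : Set V) (hB : ∀ v ∈ B, supLevel x₀ (ι v) ≤ n ∨ 29 * (n : ℤ) ≤ supLevel x₀ (ι v)) :
    (1 - c) ^ 2 * (min c₁ c₂) ^ 4 ≤
      (rcMeasure G criticalFKIsingParam 2 B).real (insulatedCircuitEvent G ι x₀ n) :=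
  real_insulatedCircuitEvent_ge G ι x₀ criticalFKIsingParam_mem_Icc criticalFKIsingParam_lt_one'
    (by norm_num) B hGlat hn hB hc0 hc1
    (fun m hm ↦ by rw [← fkIsingFiniteMeasure_eq_finsetGraph]; exact hann m hm)
    (pow_four_le_real_circuitEvent G ι x₀ hm0 hc₁ hc₂ hGlat hn hfill hadj B hB)

end Final

end Literature.Probability.LatticeModels

end
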